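import Summits.ResolutionOfSingularities.ResolutionOfSingularities.Theorems.EquisingularLiftCampaignW45bBadPointCriterionChart
import Summits.ResolutionOfSingularities.ResolutionOfSingularities.Theorems.EquisingularLiftCampaignW45bBlowupStalkDictionary
import HarnessLib

/-!
# [OURS · L1 W4.5(b)] L2-SCHEME: the singular points of a blow-up over a point where the centre is a non-regular lci trace `V(e, w)`

Crux chain w45b, working crux EL♮ = `Theses.EquisingularLift.EquisingularLiftNat` (stmt-ResolutionOfSingularities-20038), stub
`stub_elnat_three_isolated`; the COORDINATE-FREE reading of L2 «UNIQUE BAD POINT» (CRUX-PLAN v1.1 §3.4, res-L1-w45b-plan-1) at the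
points of an arbitrary blowing up, through the dictionary `…CampaignW45bBlowupStalkDictionary` (p506193) and the all-primes chart
criterion `…CampaignW45bBadPointCriterionChart`. OURS; NOT a statement of any manuscript; AI-written, weaker than expert review.
`--supports stmt-ResolutionOfSingularities-20038 --as helper`.

SETTING: `π : X′ → X` a blowing up along `J` (`IsBlowup`), `x′ ∈ X′` over `s`, `𝒪_{X,s}` regular local with algebraically closed
residue field, and `J_s = (e, w)` with `e ∈ 𝔪_s ∖ 𝔪_s²`, `w ∈ 𝔪_s²`, `w ∉ (e)` — the special-fibre trace of a Δ-centre or comb of the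
EL♮ game, read in the special fibre of the ambient. MAIN RESULT:

* **`not_isRegularLocalRing_stalk_iff_dvd`** — `𝒪_{X′,x′}` is NOT regular iff, in `𝒪_{X′,x′}`, `e ∣ w` and `w ∤ e` (images under
  `π♯`). Equivalently: `x′` is a regular point of `X′` iff `w ∣ e` at `x′` OR `e ∤ w` at `x′`. Since the exceptional ideal
  `J·𝒪_{X′,x′}` is invertible and generated by `e` or by `w`, this says: the non-regular points over `s` are exactly those where `e`
  generates and `w/e` vanishes — the single bad point `𝔓₀` of the `e`-chart (AVOID-L1 p501026 keeps equimultiple strict transforms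
  away from it; everywhere else over `s` sections exist, T_sec p497593/p502282).
* `exists_blowupAlgebra_stalk_ringEquiv_pair` — the dictionary p506193 for a two-generated centre `(e, w)`: the local ring of
  `x′` is a localization of the `e`-chart or of the `w`-chart, compatibly with `π♯`.

References: res-L1-w45b-plan-1 CRUX-PLAN v1.1 §3.4 L2, v3 §1.1 «Bl_Z creates bad points exactly over Sing Z» (OURS); The Stacks
Project, Tag 0804 — context.
-/

noncomputable section

set_option linter.dupNamespace false -- mandated namespace `Summit.<Summit>.<Problem>` of this single-conjunct summit

open CategoryTheory AlgebraicGeometry TopologicalSpace IsLocalRing IsLocalization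
open Literature.AlgebraicGeometry.Resolution

namespace Summit.ResolutionOfSingularities.ResolutionOfSingularities.Cruxes.EquisingularLiftNat.Sections

universe u

/-- `Set.range ![e, w] = {e, w}`. [folklore] -/
theorem range_vec2 {R : Type u} (e w : R) : Set.range ![e, w] = {e, w} := by
  ext x
  simp only [Set.mem_range, Fin.exists_fin_two, Matrix.cons_val_zero, Matrix.cons_val_one, Set.mem_insert_iff,
    Set.mem_singleton_iff]
  constructor
  · rintro (h | h)
    · exact Or.inl h.symm
    · exact Or.inr h.symm
  · rintro (h | h)
    · exact Or.inl h.symm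
    · exact Or.inr h.symm

/-- Divisibility read through a dictionary `T ≃ L` compatible with `σ : S → T`, `ι : S → B`, `λ : B → L`. [folklore] -/
theorem dvd_iff_of_dictionary {S T B L : Type u} [CommRing S] [CommRing T] [CommRing B] [CommRing L]
    (σ : S →+* T) (ι : S →+* B) (lam : B →+* L) (χ : B →+* T) (φ : T ≃+* L)
    (hχ : ∀ a, χ (ι a) = σ a) (hφ : ∀ b, φ (χ b) = lam b) (a b : S) :
    σ a ∣ σ b ↔ lam (ι a) ∣ lam (ι b) := by
  rw [← hχ, ← hχ, ← hφ, ← hφ]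
  exact ⟨fun h => map_dvd φ h, fun h => by simpa using map_dvd φ.symm h⟩

section Chart

variable {R : Type u} [CommRing R] [IsRegularLocalRing R] {e w : R}

/-- In the `e`-chart: for a prime `𝔔` of `B = R[Z/e]`, «`w/1 ∣ e/1` in `B_𝔔`» iff `w/e ∉ 𝔔` (`w = e·(w/e)` and `B_𝔔` is a domain).
[folklore] -/
theorem dvd_iff_gen_notMem_eChart (he₂ : e ∉ maximalIdeal R ^ 2)
    (𝔔 : Ideal (blowupAlgebra (Ideal.span {e, w}) e)) [𝔔.IsPrime] :
    algebraMap _ (Localization.AtPrime 𝔔) (algebraMap R (blowupAlgebra (Ideal.span {e, w}) e) w) ∣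
      algebraMap _ (Localization.AtPrime 𝔔) (algebraMap R (blowupAlgebra (Ideal.span {e, w}) e) e) ↔
    blowupAlgebra.gen (Ideal.span {e, w}) e w (mem_span_pair_right e w) ∉ 𝔔 := by
  haveI := isDomain_of_isRegularLocalRing R
  have he0 : e ≠ 0 := by rintro rfl; exact he₂ (Ideal.zero_mem _)
  haveI : IsDomain (Localization.Away e) :=
    IsLocalization.isDomain_localization (powers_le_nonZeroDivisors_of_noZeroDivisors he0)
  haveI : IsDomain (Localization.AtPrime 𝔔) :=
    IsLocalization.isDomain_localization 𝔔.primeCompl_le_nonZeroDivisors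
  have hwt : algebraMap R (blowupAlgebra (Ideal.span {e, w}) e) w =
      algebraMap R (blowupAlgebra (Ideal.span {e, w}) e) e *
        blowupAlgebra.gen (Ideal.span {e, w}) e w (mem_span_pair_right e w) :=
    (blowupAlgebra.algebraMap_mul_gen _ e w _).symm
  have heB : algebraMap R (blowupAlgebra (Ideal.span {e, w}) e) e ≠ 0 := by
    intro h
    apply he0
    have hinjL : Function.Injective (algebraMap R (Localization.Away e)) :=
      IsLocalization.injective _ (powers_le_nonZeroDivisors_of_noZeroDivisors he0)
    apply hinjL
    have h' := congrArg (Subtype.val : blowupAlgebra (Ideal.span {e, w}) e → Localization.Away e) h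
    simpa [Subalgebra.coe_algebraMap] using h'
  have heL : algebraMap _ (Localization.AtPrime 𝔔) (algebraMap R (blowupAlgebra (Ideal.span {e, w}) e) e) ≠ 0 :=
    fun h => heB (IsLocalization.injective (Localization.AtPrime 𝔔) 𝔔.primeCompl_le_nonZeroDivisors
      (by rw [h, map_zero]))
  suffices h : algebraMap _ (Localization.AtPrime 𝔔) (algebraMap R (blowupAlgebra (Ideal.span {e, w}) e) w) ∣
      algebraMap _ (Localization.AtPrime 𝔔) (algebraMap R (blowupAlgebra (Ideal.span {e, w}) e) e) ↔
      IsUnit (algebraMap _ (Localization.AtPrime 𝔔)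
        (blowupAlgebra.gen (Ideal.span {e, w}) e w (mem_span_pair_right e w))) by
    exact h.trans ((IsLocalization.AtPrime.isUnit_to_map_iff (Localization.AtPrime 𝔔) 𝔔 _).trans Iff.rfl)
  constructor
  · rintro ⟨s, hs⟩
    rw [hwt, map_mul, mul_assoc] at hs
    exact isUnit_iff_exists_inv.mpr ⟨s, mul_left_cancel₀ heL (hs.symm.trans (mul_one _).symm)⟩
  · intro hu
    obtain ⟨s, hs⟩ := hu.exists_right_inv
    exact ⟨s, by rw [hwt, map_mul, mul_assoc, hs, mul_one]⟩

omit [IsRegularLocalRing R] in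
/-- In either chart, `e/1 ∣ w/1` resp. `w/1 ∣ e/1` whenever the other generator is the chart element (`w = e·(w/e)`,
`e = w·(e/w)`). [folklore] -/
theorem dvd_of_chart (I : Ideal R) (a : R) {b : R} (hb : b ∈ I) (L : Type u) [CommRing L]
    [Algebra (blowupAlgebra I a) L] :
    algebraMap _ L (algebraMap R (blowupAlgebra I a) a) ∣ algebraMap _ L (algebraMap R (blowupAlgebra I a) b) :=
  ⟨algebraMap _ L (blowupAlgebra.gen I a b hb), by rw [← map_mul, blowupAlgebra.algebraMap_mul_gen]⟩

end Chart

/-! ## The coordinate-free criterion -/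

variable {X' X : Scheme.{u}} {π : X' ⟶ X} {J : X.IdealSheafData}

/-- **Dictionary for a two-generated centre** (pair form of `exists_blowupAlgebra_stalk_ringEquiv`, p506193): if `J_s = (e, w)` at
`s = π x′`, then `𝒪_{X′,x′}` is — compatibly with `π♯` — a localization of the `e`-chart `R[J_s/e]` or of the `w`-chart `R[J_s/w]` at a
prime over `𝔪_s`. [cite: StacksProject, Tag 0804] -/
theorem exists_blowupAlgebra_stalk_ringEquiv_pair (hπ : IsBlowup π J) (x' : X') (e w : X.presheaf.stalk (π x'))
    (hJ : Ideal.span {e, w} = stalkIdeal J (π x')) :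
    (∃ (𝔔 : PrimeSpectrum (blowupAlgebra (Ideal.span {e, w}) e))
        (χ : blowupAlgebra (Ideal.span {e, w}) e →+* X'.presheaf.stalk x')
        (φ : X'.presheaf.stalk x' ≃+* Localization.AtPrime 𝔔.asIdeal),
        (∀ a, χ (algebraMap _ _ a) = (π.stalkMap x').hom a) ∧
        (∀ b, φ (χ b) = algebraMap _ (Localization.AtPrime 𝔔.asIdeal) b) ∧
        𝔔.asIdeal.comap (algebraMap _ (blowupAlgebra (Ideal.span {e, w}) e)) = maximalIdeal (X.presheaf.stalk (π x'))) ∨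
    (∃ (𝔔 : PrimeSpectrum (blowupAlgebra (Ideal.span {e, w}) w))
        (χ : blowupAlgebra (Ideal.span {e, w}) w →+* X'.presheaf.stalk x')
        (φ : X'.presheaf.stalk x' ≃+* Localization.AtPrime 𝔔.asIdeal),
        (∀ a, χ (algebraMap _ _ a) = (π.stalkMap x').hom a) ∧
        (∀ b, φ (χ b) = algebraMap _ (Localization.AtPrime 𝔔.asIdeal) b) ∧
        𝔔.asIdeal.comap (algebraMap _ (blowupAlgebra (Ideal.span {e, w}) w)) = maximalIdeal (X.presheaf.stalk (π x'))) := by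
  have hI : Ideal.span {e, w} = Ideal.span (Set.range ![e, w]) := by rw [range_vec2]
  obtain ⟨j, h⟩ := exists_blowupAlgebra_stalk_ringEquiv_of_eq hπ x' ![e, w] (Ideal.span {e, w}) hI hJ
  fin_cases j
  · exact Or.inl h
  · exact Or.inr h

/-- **L2-SCHEME — the non-regular points of `Bl_{V(e,w)}` over the closed point.** Let `π : X′ → X` be a blowing up along `J`,
`x′ ∈ X′`, `s = π x′`, with `𝒪_{X,s}` regular local, its residue field algebraically closed, and `J_s = (e, w)` where `e ∈ 𝔪_s ∖ 𝔪_s²`,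
`w ∈ 𝔪_s²`, `w ∉ (e)`. Then `𝒪_{X′,x′}` is NOT a regular local ring iff `π♯e ∣ π♯w` and `π♯w ∤ π♯e` in `𝒪_{X′,x′}` — i.e. iff `x′` is
THE bad point: the exceptional ideal is generated by `e` at `x′` and `w/e` vanishes there. All other points of `X′` over `s` are
regular. [folklore; CRUX-PLAN v1.1 §3.4 L2 at the scheme level] -/
theorem not_isRegularLocalRing_stalk_iff_dvd (hπ : IsBlowup π J) (x' : X')
    [IsRegularLocalRing (X.presheaf.stalk (π x'))] [IsAlgClosed (ResidueField (X.presheaf.stalk (π x')))]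
    {e w : X.presheaf.stalk (π x')} (he : e ∈ maximalIdeal (X.presheaf.stalk (π x')))
    (he₂ : e ∉ maximalIdeal (X.presheaf.stalk (π x')) ^ 2) (hw : w ∈ maximalIdeal (X.presheaf.stalk (π x')) ^ 2)
    (hwe : w ∉ Ideal.span {e}) (hJ : Ideal.span {e, w} = stalkIdeal J (π x')) :
    ¬ IsRegularLocalRing (X'.presheaf.stalk x') ↔
      ((π.stalkMap x').hom e ∣ (π.stalkMap x').hom w ∧ ¬ (π.stalkMap x').hom w ∣ (π.stalkMap x').hom e) := by
  rcases exists_blowupAlgebra_stalk_ringEquiv_pair hπ x' e w hJ with ⟨𝔔, χ, φ, hχ, hφ, h𝔔⟩ | ⟨𝔔, χ, φ, hχ, hφ, h𝔔⟩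
  · -- the `e`-chart `R[Z/e]`
    have hm : (maximalIdeal (X.presheaf.stalk (π x'))).map
        (algebraMap (X.presheaf.stalk (π x')) (blowupAlgebra (Ideal.span {e, w}) e)) ≤ 𝔔.asIdeal :=
      Ideal.map_le_iff_le_comap.mpr h𝔔.ge
    have key := dvd_iff_of_dictionary (L := Localization.AtPrime 𝔔.asIdeal) (π.stalkMap x').hom
      (algebraMap _ (blowupAlgebra (Ideal.span {e, w}) e)) (algebraMap _ (Localization.AtPrime 𝔔.asIdeal)) χ φ hχ hφ
    have hreg : IsRegularLocalRing (X'.presheaf.stalk x') ↔ IsRegularLocalRing (Localization.AtPrime 𝔔.asIdeal) :=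
      ⟨fun h => @IsRegularLocalRing.of_ringEquiv _ _ h _ _ φ, fun h => @IsRegularLocalRing.of_ringEquiv _ _ h _ _ φ.symm⟩
    have hew : (π.stalkMap x').hom e ∣ (π.stalkMap x').hom w :=
      (key e w).mpr (dvd_of_chart (Ideal.span {e, w}) e (mem_span_pair_right e w) (Localization.AtPrime 𝔔.asIdeal))
    have hwe' : ((π.stalkMap x').hom w ∣ (π.stalkMap x').hom e) ↔
        blowupAlgebra.gen (Ideal.span {e, w}) e w (mem_span_pair_right e w) ∉ 𝔔.asIdeal :=
      (key w e).trans (dvd_iff_gen_notMem_eChart he₂ 𝔔.asIdeal)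
    have hcrit := isRegularLocalRing_localization_eChart_iff he he₂ hw hwe 𝔔.asIdeal hm
    constructor
    · intro h
      exact ⟨hew, fun hd => h (hreg.mpr (hcrit.mpr (hwe'.mp hd)))⟩
    · rintro ⟨-, hd⟩ h
      exact hd (hwe'.mpr (hcrit.mp (hreg.mp h)))
  · -- the `w`-chart `R[Z/w]`: every point is regular, and `w ∣ e`
    have hm : (maximalIdeal (X.presheaf.stalk (π x'))).map
        (algebraMap (X.presheaf.stalk (π x')) (blowupAlgebra (Ideal.span {e, w}) w)) ≤ 𝔔.asIdeal :=
      Ideal.map_le_iff_le_comap.mpr h𝔔.ge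
    have key := dvd_iff_of_dictionary (L := Localization.AtPrime 𝔔.asIdeal) (π.stalkMap x').hom
      (algebraMap _ (blowupAlgebra (Ideal.span {e, w}) w)) (algebraMap _ (Localization.AtPrime 𝔔.asIdeal)) χ φ hχ hφ
    have hreg : IsRegularLocalRing (X'.presheaf.stalk x') :=
      @IsRegularLocalRing.of_ringEquiv _ _ (isRegularLocalRing_localization_wChart' he he₂ hw hwe 𝔔.asIdeal hm) _ _ φ.symm
    have hwe' : (π.stalkMap x').hom w ∣ (π.stalkMap x').hom e :=
      (key w e).mpr (dvd_of_chart (Ideal.span {e, w}) w (b := e) (Ideal.subset_span (by simp))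
        (Localization.AtPrime 𝔔.asIdeal))
    exact ⟨fun h => absurd hreg h, fun h => absurd hwe' h.2⟩

/-- **Corollary: regular points over `s`.** Under the same hypotheses `𝒪_{X′,x′}` is regular as soon as `π♯w ∣ π♯e` at `x′`
(the `w`-chart and all points of the `e`-chart where `w/e` is a unit) or `π♯e ∤ π♯w`. [folklore] -/
theorem isRegularLocalRing_stalk_of_dvd (hπ : IsBlowup π J) (x' : X')
    [IsRegularLocalRing (X.presheaf.stalk (π x'))] [IsAlgClosed (ResidueField (X.presheaf.stalk (π x')))]
    {e w : X.presheaf.stalk (π x')} (he : e ∈ maximalIdeal (X.presheaf.stalk (π x')))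
    (he₂ : e ∉ maximalIdeal (X.presheaf.stalk (π x')) ^ 2) (hw : w ∈ maximalIdeal (X.presheaf.stalk (π x')) ^ 2)
    (hwe : w ∉ Ideal.span {e}) (hJ : Ideal.span {e, w} = stalkIdeal J (π x'))
    (h : (π.stalkMap x').hom w ∣ (π.stalkMap x').hom e) : IsRegularLocalRing (X'.presheaf.stalk x') := by
  by_contra hnot
  exact ((not_isRegularLocalRing_stalk_iff_dvd hπ x' he he₂ hw hwe hJ).mp hnot).2 h

end Summit.ResolutionOfSingularities.ResolutionOfSingularities.Cruxes.EquisingularLiftNat.Sections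

end
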